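import Summits.RiemannHypothesis.RiemannHypothesis.Theorems.UniversalFactorLaplaceLoopholeConvolution
import Literature.NumberTheory.LFunctions.TuringMethod
import Literature.NumberTheory.LFunctions.DobnerNewman
import Literature.NumberTheory.LFunctions.DeBruijnHZeroProofs
import Mathlib.Analysis.Calculus.ParametricIntegral
import Mathlib.MeasureTheory.Measure.Haar.NormedSpace
import Mathlib.MeasureTheory.Integral.Bochner.ContinuousLinearMap

/-!
# RiemannHypothesis / UniversalFactor — `NarrowKernelNoGo` (stmt-RiemannHypothesis-2576),
line `Sketch`: stub P1 `stub_narrowConvolution` (the Laplace smoothing on the critical line)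

Route `RiemannHypothesis/UniversalFactor`, crux `NarrowKernelNoGo`. With
`F_a = deBruijnHDiv (fun u ↦ 1 + u²/a²)` (the Laplace(a)-smoothing of `H_0 = deBruijnH 0`,
`F_a = (a/2)e^{−a|·|} ∗ H_0`, `deBruijnHDiv_laplace_eq_conv`), `E(τ) = ‖γ(1/2 + iτ)‖`
(`γ = xiGammaFactor`, `ξ = γ ζ`) and Hardy's `Z = hardyZ`, we prove for `a > π/8` (only `a > 0` is
used) and real `t`:

* kernel calculus (`b > 0`, `g` bounded continuous): `UniversalFactor.narrowConv_hasDerivAt_kernel`,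
  `s ↦ ∫ℝ e^{−b|u|} g(s+u) du` has derivative `∫ℝ b·sgn(u) e^{−b|u|} g(t+u) du` (Mathlib's
  `hasDerivAt_integral_of_dominated_loc_of_lip` after the translation `v = s + u`: the kernel
  `x ↦ e^{−b|v − x|}` is Lipschitz on `ball t 1` with constant `b e^{b} e^{−b|v−t|}` and
  differentiable at `x = t` for `v ≠ t`), and `UniversalFactor.narrowConv_continuous_kernel`, the
  derivative integral is continuous in `s` (dominated convergence);
* `UniversalFactor.narrowConv_xiGammaFactor_half` — `γ(1/2 + iτ) = −E(τ) e^{iϑ(τ)}`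
  (`s(s−1)/2 = −(τ² + 1/4)/2`, `Γ_ℝ(1/2+iτ) = π^{-1/4} G(s(τ))`, `G/|G| = e^{iϑ}`: the tree's
  `Gammaℝ_half_add_mul_I`, `cexp_theta_mul_I_eq_thetaGamma_div_norm`), hence
  `UniversalFactor.narrowConv_riemannXi_half` — `ξ(1/2 + iτ) = −E(τ) Z(τ)` and
  `UniversalFactor.narrowConv_deBruijnH_two_mul` — `H_0(2τ) = −E(τ)Z(τ)/8`;
* `UniversalFactor.narrowConv_laplace_two_mul` — `F_a(2t) = −(a/8) ∫ℝ e^{−2a|u|} E(t+u) Z(t+u) du`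
  (substitution `y = −2u` in the convolution);
* `UniversalFactor.stub_narrowConvolution` — the registered stub (formula, `t`-derivative,
  continuity).

Sign check: `ξ(1/2) ≈ 0.497 > 0`, `Z(0) = ζ(1/2) ≈ −1.46 < 0`, `E > 0` — consistent with `ξ = −E·Z`.

References: Titchmarsh, *The Theory of the Riemann Zeta-Function* (1986), §2.1, §4.17 (`ϑ`, `Z`).
-/

noncomputable section

-- D-0017: `Summit.<S>.<S>.…` is the designed namespace of a single-problem summit.
set_option linter.dupNamespace false

namespace Summit.RiemannHypothesis.RiemannHypothesis.Theorems

open MeasureTheory Set Filter Complex intervalIntegral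
open scoped Real Topology
open Literature.NumberTheory.LFunctions

/-! ## Elementary lemmas -/

/-- `v ↦ sgn(v − t)` is measurable (`Real.sign` is two `ite`s over the measurable sets `(-∞,0)`,
`(0,∞)`). [folklore] -/
theorem UniversalFactor.narrowConv_measurable_sign_sub (t : ℝ) :
    Measurable fun v : ℝ => Real.sign (v - t) := by
  have h : Real.sign = fun r : ℝ => if r < 0 then (-1 : ℝ) else if 0 < r then 1 else 0 := by
    funext r; rfl
  have hs : Measurable Real.sign := by
    rw [h]
    exact Measurable.ite measurableSet_Iio measurable_const
      (Measurable.ite measurableSet_Ioi measurable_const measurable_const)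
  exact hs.comp (measurable_id.sub_const t)

/-- `|e^{−p} − e^{−q}| ≤ e^{−min(p,q)} |p − q|` (mean value inequality for `exp` in the elementary
form `1 − e^{−h} ≤ h`). [folklore] -/
theorem UniversalFactor.narrowConv_abs_exp_neg_sub_le (p q : ℝ) :
    |Real.exp (-p) - Real.exp (-q)| ≤ Real.exp (-min p q) * |p - q| := by
  wlog hpq : p ≤ q generalizing p q
  · have h := this q p (le_of_not_ge hpq)
    rwa [abs_sub_comm, min_comm, abs_sub_comm q p] at h
  rw [min_eq_left hpq]
  have h1 : Real.exp (-q) ≤ Real.exp (-p) := Real.exp_le_exp.2 (neg_le_neg hpq)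
  rw [abs_of_nonneg (sub_nonneg.2 h1), abs_of_nonpos (sub_nonpos.2 hpq)]
  have h2 : Real.exp (-q) = Real.exp (-p) * Real.exp (p - q) := by
    rw [← Real.exp_add]; ring_nf
  have h3 : p - q + 1 ≤ Real.exp (p - q) := Real.add_one_le_exp _
  nlinarith [Real.exp_pos (-p)]

/-- Translation `v = s + u` in the kernel integral: `∫ f(u) g(s+u) du = ∫ f(v − s) g(v) dv`.
[folklore] -/
theorem UniversalFactor.narrowConv_integral_shift (f g : ℝ → ℝ) (s : ℝ) :
    ∫ u : ℝ, f u * g (s + u) = ∫ v : ℝ, f (v - s) * g v := by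
  rw [← integral_add_right_eq_self (fun v => f (v - s) * g v) s]
  congr 1
  funext u
  rw [add_sub_cancel_right, add_comm u s]

/-- The kernel `x ↦ e^{−b|v − x|}` is Lipschitz on `ball t 1` with constant `b e^{b} e^{−b|v−t|}`
(`b > 0`): `|e^{−b|v−x|} − e^{−b|v−y|}| ≤ b e^{b} e^{−b|v−t|} |x − y|` for `|x − t|, |y − t| < 1`.
[folklore] -/
theorem UniversalFactor.narrowConv_kernel_lipschitz {b : ℝ} (hb : 0 < b) (v t : ℝ) {x y : ℝ}
    (hx : |x - t| < 1) (hy : |y - t| < 1) :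
    |Real.exp (-(b * |v - x|)) - Real.exp (-(b * |v - y|))| ≤
      b * Real.exp b * Real.exp (-(b * |v - t|)) * |x - y| := by
  have h1 := UniversalFactor.narrowConv_abs_exp_neg_sub_le (b * |v - x|) (b * |v - y|)
  have h2 : abs (b * |v - x| - b * |v - y|) ≤ b * |x - y| := by
    rw [← mul_sub, abs_mul, abs_of_pos hb]
    refine mul_le_mul_of_nonneg_left ?_ hb.le
    calc abs (|v - x| - |v - y|) ≤ |(v - x) - (v - y)| := abs_abs_sub_abs_le_abs_sub _ _
      _ = |x - y| := by rw [show (v - x) - (v - y) = -(x - y) by ring, abs_neg]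
  have h3 : Real.exp (-min (b * |v - x|) (b * |v - y|)) ≤
      Real.exp b * Real.exp (-(b * |v - t|)) := by
    rw [← Real.exp_add, Real.exp_le_exp]
    have hx' : b * |v - t| - b ≤ b * |v - x| := by
      have : |v - t| - |v - x| ≤ |x - t| := by
        calc |v - t| - |v - x| ≤ |(v - t) - (v - x)| := abs_sub_abs_le_abs_sub _ _
          _ = |x - t| := by rw [show (v - t) - (v - x) = x - t by ring]
      nlinarith
    have hy' : b * |v - t| - b ≤ b * |v - y| := by
      have : |v - t| - |v - y| ≤ |y - t| := by
        calc |v - t| - |v - y| ≤ |(v - t) - (v - y)| := abs_sub_abs_le_abs_sub _ _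
          _ = |y - t| := by rw [show (v - t) - (v - y) = y - t by ring]
      nlinarith
    have := le_min hx' hy'
    linarith
  calc |Real.exp (-(b * |v - x|)) - Real.exp (-(b * |v - y|))|
      ≤ Real.exp (-min (b * |v - x|) (b * |v - y|)) * abs (b * |v - x| - b * |v - y|) := h1
    _ ≤ (Real.exp b * Real.exp (-(b * |v - t|))) * (b * |x - y|) :=
        mul_le_mul h3 h2 (abs_nonneg _) (by positivity)
    _ = b * Real.exp b * Real.exp (-(b * |v - t|)) * |x - y| := by ring

/-- For `v ≠ t`, `x ↦ e^{−b|v − x|} c` has derivative `b·sgn(v − t) e^{−b|v − t|} c` at `x = t`.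
[folklore] -/
theorem UniversalFactor.narrowConv_hasDerivAt_kernel_pt (b c : ℝ) {v t : ℝ} (hv : v ≠ t) :
    HasDerivAt (fun x : ℝ => Real.exp (-(b * |v - x|)) * c)
      (b * Real.sign (v - t) * Real.exp (-(b * |v - t|)) * c) t := by
  rcases lt_or_gt_of_ne hv with hlt | hgt
  · -- `v < t`: near `t`, `|v - x| = x - v`
    have hev : ∀ᶠ x in 𝓝 t, Real.exp (-(b * (x - v))) * c = Real.exp (-(b * |v - x|)) * c := by
      filter_upwards [eventually_gt_nhds hlt] with x hx
      rw [abs_of_neg (sub_neg.2 hx), neg_sub]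
    have hd : HasDerivAt (fun x : ℝ => Real.exp (-(b * (x - v))) * c)
        (Real.exp (-(b * (t - v))) * (-b) * c) t := by
      have h1 : HasDerivAt (fun x : ℝ => -(b * (x - v))) (-b) t := by
        simpa using (((hasDerivAt_id t).sub_const v).const_mul b).fun_neg
      simpa using h1.exp.mul_const c
    refine (hd.congr_of_eventuallyEq (EventuallyEq.symm hev)).congr_deriv ?_
    rw [Real.sign_of_neg (sub_neg.2 hlt), abs_of_neg (sub_neg.2 hlt), neg_sub]
    ring
  · -- `t < v`: near `t`, `|v - x| = v - x`
    have hev : ∀ᶠ x in 𝓝 t, Real.exp (-(b * (v - x))) * c = Real.exp (-(b * |v - x|)) * c := by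
      filter_upwards [eventually_lt_nhds hgt] with x hx
      rw [abs_of_pos (sub_pos.2 hx)]
    have hd : HasDerivAt (fun x : ℝ => Real.exp (-(b * (v - x))) * c)
        (Real.exp (-(b * (v - t))) * b * c) t := by
      have h1 : HasDerivAt (fun x : ℝ => -(b * (v - x))) b t := by
        simpa using (((hasDerivAt_id t).const_sub v).const_mul b).fun_neg
      simpa using h1.exp.mul_const c
    refine (hd.congr_of_eventuallyEq (EventuallyEq.symm hev)).congr_deriv ?_
    rw [Real.sign_of_pos (sub_pos.2 hgt), abs_of_pos (sub_pos.2 hgt)]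
    ring

/-! ## The derivative of the smoothing falls on the kernel -/

/-- **Differentiation of the two-sided exponential smoothing.** For `b > 0` and a bounded continuous
`g`, `s ↦ ∫ℝ e^{−b|u|} g(s+u) du` has derivative `∫ℝ b·sgn(u) e^{−b|u|} g(t+u) du` at every `t`.
[folklore] -/
theorem UniversalFactor.narrowConv_hasDerivAt_kernel {b M : ℝ} {g : ℝ → ℝ} (hb : 0 < b)
    (hg : Continuous g) (hM : ∀ τ, |g τ| ≤ M) (t : ℝ) :
    HasDerivAt (fun s : ℝ => ∫ u : ℝ, Real.exp (-(b * |u|)) * g (s + u))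
      (∫ u : ℝ, (b * Real.sign u) * Real.exp (-(b * |u|)) * g (t + u)) t := by
  have hM0 : 0 ≤ M := (abs_nonneg _).trans (hM 0)
  -- translate `v = s + u`
  have hshift : (fun s : ℝ => ∫ u : ℝ, Real.exp (-(b * |u|)) * g (s + u)) =
      fun s => ∫ v : ℝ, Real.exp (-(b * |v - s|)) * g v := by
    funext s
    exact UniversalFactor.narrowConv_integral_shift (fun u => Real.exp (-(b * |u|))) g s
  have hshift' : (∫ u : ℝ, (b * Real.sign u) * Real.exp (-(b * |u|)) * g (t + u)) =
      ∫ v : ℝ, (b * Real.sign (v - t)) * Real.exp (-(b * |v - t|)) * g v :=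
    UniversalFactor.narrowConv_integral_shift
      (fun u => (b * Real.sign u) * Real.exp (-(b * |u|))) g t
  rw [hshift, hshift']
  have hk_int : Integrable (fun v : ℝ => Real.exp (-(b * |v - t|))) :=
    (integrable_exp_neg_mul_abs hb).comp_sub_right t
  have hsm := UniversalFactor.narrowConv_measurable_sign_sub t
  have key := _root_.hasDerivAt_integral_of_dominated_loc_of_lip (μ := volume)
    (F := fun x v => Real.exp (-(b * |v - x|)) * g v)
    (F' := fun v => (b * Real.sign (v - t)) * Real.exp (-(b * |v - t|)) * g v) (x₀ := t)
    (bound := fun v => b * Real.exp b * Real.exp (-(b * |v - t|)) * M) (s := Metric.ball t 1)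
    (Metric.ball_mem_nhds t one_pos) ?_ ?_ ?_ ?_ ?_ ?_
  · exact key.2
  · -- measurability of `F x`
    exact Eventually.of_forall fun x => Continuous.aestronglyMeasurable (by fun_prop)
  · -- integrability of `F t`
    refine (hk_int.mul_const M).mono' (Continuous.aestronglyMeasurable (by fun_prop))
      (Eventually.of_forall fun v => ?_)
    rw [Real.norm_eq_abs, abs_mul, abs_of_pos (Real.exp_pos _)]
    exact mul_le_mul_of_nonneg_left (hM v) (Real.exp_pos _).le
  · -- measurability of `F'`
    exact (((measurable_const.mul hsm).mul
      (by fun_prop : Continuous fun v : ℝ => Real.exp (-(b * |v - t|))).measurable).mul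
        hg.measurable).aestronglyMeasurable
  · -- the Lipschitz bound
    refine Eventually.of_forall fun v => LipschitzOnWith.of_dist_le_mul fun x hx y hy => ?_
    rw [Metric.mem_ball, Real.dist_eq] at hx hy
    rw [Real.dist_eq, Real.dist_eq, Real.coe_nnabs,
      abs_of_nonneg (show (0 : ℝ) ≤ b * Real.exp b * Real.exp (-(b * |v - t|)) * M by positivity),
      ← sub_mul, abs_mul]
    calc |Real.exp (-(b * |v - x|)) - Real.exp (-(b * |v - y|))| * |g v|
        ≤ (b * Real.exp b * Real.exp (-(b * |v - t|)) * |x - y|) * M :=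
          mul_le_mul (UniversalFactor.narrowConv_kernel_lipschitz hb v t hx hy) (hM v)
            (abs_nonneg _) (by positivity)
      _ = b * Real.exp b * Real.exp (-(b * |v - t|)) * M * |x - y| := by ring
  · -- integrability of the bound
    exact (hk_int.const_mul (b * Real.exp b)).mul_const M
  · -- the pointwise derivative at `x = t`, for `v ≠ t`
    have hae : ∀ᵐ v ∂(volume : Measure ℝ), v ≠ t := by rw [ae_iff]; simp
    exact hae.mono fun v hv => UniversalFactor.narrowConv_hasDerivAt_kernel_pt b (g v) hv

/-- **Continuity of the derivative integral** `s ↦ ∫ℝ b·sgn(u) e^{−b|u|} g(s+u) du` for `b > 0` and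
a bounded continuous `g` (dominated convergence, majorant `b e^{−b|u|} M`). [folklore] -/
theorem UniversalFactor.narrowConv_continuous_kernel {b M : ℝ} {g : ℝ → ℝ} (hb : 0 < b)
    (hg : Continuous g) (hM : ∀ τ, |g τ| ≤ M) :
    Continuous (fun s : ℝ => ∫ u : ℝ, (b * Real.sign u) * Real.exp (-(b * |u|)) * g (s + u)) := by
  have hM0 : 0 ≤ M := (abs_nonneg _).trans (hM 0)
  have hsm : Measurable Real.sign := by
    simpa only [sub_zero] using UniversalFactor.narrowConv_measurable_sign_sub 0
  refine continuous_of_dominated (bound := fun u => b * Real.exp (-(b * |u|)) * M) ?_ ?_ ?_ ?_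
  · intro s
    exact (((measurable_const.mul hsm).mul
      (by fun_prop : Continuous fun u : ℝ => Real.exp (-(b * |u|))).measurable).mul
        (hg.comp (continuous_const.add continuous_id)).measurable).aestronglyMeasurable
  · intro s
    refine Eventually.of_forall fun u => ?_
    rw [Real.norm_eq_abs, abs_mul, abs_mul, abs_mul, abs_of_pos hb, abs_of_pos (Real.exp_pos _)]
    calc b * |Real.sign u| * Real.exp (-(b * |u|)) * |g (s + u)|
        ≤ b * 1 * Real.exp (-(b * |u|)) * M := by
          gcongr
          · rcases Real.sign_apply_eq u with h | h | h <;> simp [h]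
          · exact hM _
      _ = b * Real.exp (-(b * |u|)) * M := by ring
  · exact ((integrable_exp_neg_mul_abs hb).const_mul b).mul_const M
  · exact Eventually.of_forall fun u => by fun_prop

/-! ## `ξ` on the critical line: `ξ(1/2 + iτ) = −E(τ) Z(τ)` -/

/-- `s(s − 1)/2 = −(τ² + 1/4)/2` at `s = 1/2 + iτ`. [folklore] -/
theorem UniversalFactor.narrowConv_half_mul (τ : ℝ) :
    (1 / 2 + (τ : ℂ) * I) * (1 / 2 + (τ : ℂ) * I - 1) / 2 = -(((τ ^ 2 + 1 / 4) / 2 : ℝ) : ℂ) := by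
  have hI : (I : ℂ) * I = -1 := Complex.I_mul_I
  push_cast
  linear_combination (τ : ℂ) ^ 2 / 2 * hI

/-- **The phase of the gamma factor on the critical line**: `γ(1/2 + iτ) = −‖γ(1/2 + iτ)‖ e^{iϑ(τ)}`
(`γ(s) = s(s−1)/2 · Γ_ℝ(s)`, `Γ_ℝ(1/2 + iτ) = π^{-1/4} G(s(τ))`, `G(s(τ))/|G(s(τ))| = e^{iϑ(τ)}`;
Titchmarsh §4.17). [cite: Titchmarsh1986, §4.17] -/
theorem UniversalFactor.narrowConv_xiGammaFactor_half (τ : ℝ) :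
    xiGammaFactor (1 / 2 + (τ : ℂ) * I) =
      -(‖xiGammaFactor (1 / 2 + (τ : ℂ) * I)‖ : ℂ) * cexp (riemannSiegelTheta τ * I) := by
  set G : ℂ := thetaGamma (thetaArg τ) with hGdef
  have hGne : G ≠ 0 := thetaGamma_thetaArg_ne_zero τ
  have hGnorm : (‖G‖ : ℂ) ≠ 0 := by exact_mod_cast (norm_pos_iff.2 hGne).ne'
  have hphase : cexp (riemannSiegelTheta τ * I) = G / ‖G‖ :=
    cexp_theta_mul_I_eq_thetaGamma_div_norm τ
  have hGeq : G = (‖G‖ : ℂ) * cexp (riemannSiegelTheta τ * I) := by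
    rw [hphase]; field_simp
  have hγ : xiGammaFactor (1 / 2 + (τ : ℂ) * I) =
      -((((τ ^ 2 + 1 / 4) / 2 * Real.exp (-Real.log π / 4) * ‖G‖ : ℝ)) : ℂ) *
        cexp (riemannSiegelTheta τ * I) := by
    rw [xiGammaFactor, Gammaℝ_half_add_mul_I, UniversalFactor.narrowConv_half_mul, ← hGdef]
    conv_lhs => rw [hGeq]
    push_cast
    ring
  have hnorm : ‖xiGammaFactor (1 / 2 + (τ : ℂ) * I)‖ =
      (τ ^ 2 + 1 / 4) / 2 * Real.exp (-Real.log π / 4) * ‖G‖ := by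
    rw [hγ, norm_mul, norm_neg, Complex.norm_real, Complex.norm_exp_ofReal_mul_I, mul_one,
      Real.norm_of_nonneg (by positivity)]
  rw [hnorm, hγ]

/-- **`ξ(1/2 + iτ) = −E(τ) Z(τ)`** with `E(τ) = ‖γ(1/2 + iτ)‖`, `Z` Hardy's function (`ξ = γ ζ`,
`γ(1/2+iτ) = −E(τ)e^{iϑ(τ)}`, `Z(τ) = e^{iϑ(τ)} ζ(1/2 + iτ)`; Titchmarsh §4.17).
[cite: Titchmarsh1986, §4.17] -/
theorem UniversalFactor.narrowConv_riemannXi_half (τ : ℝ) :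
    riemannXi (1 / 2 + (τ : ℂ) * I) =
      -((‖xiGammaFactor (1 / 2 + (τ : ℂ) * I)‖ * hardyZ τ : ℝ) : ℂ) := by
  have hs1 : (1 / 2 + (τ : ℂ) * I) ≠ 1 := fun h => by
    have := congrArg Complex.re h; norm_num at this
  have hG : Gammaℝ (1 / 2 + (τ : ℂ) * I) ≠ 0 := Gammaℝ_ne_zero_of_re_pos (by simp)
  rw [← xiGammaFactor_mul_riemannZeta hs1 hG]
  conv_lhs => rw [UniversalFactor.narrowConv_xiGammaFactor_half]
  push_cast
  rw [ofReal_hardyZ_holds τ]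
  ring

/-- **`H_0(2τ) = −E(τ) Z(τ)/8`** for real `τ` (`H_0(z) = ξ(1/2 + iz/2)/8`,
`deBruijnH_zero_eq_holds`). [folklore] -/
theorem UniversalFactor.narrowConv_deBruijnH_two_mul (τ : ℝ) :
    deBruijnH 0 ((2 * τ : ℝ) : ℂ) =
      -((‖xiGammaFactor (1 / 2 + (τ : ℂ) * I)‖ * hardyZ τ / 8 : ℝ) : ℂ) := by
  rw [deBruijnH_zero_eq_holds]
  have h : (1 / 2 + I * ((2 * τ : ℝ) : ℂ) / 2 : ℂ) = 1 / 2 + (τ : ℂ) * I := by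
    push_cast; ring
  rw [h, UniversalFactor.narrowConv_riemannXi_half]
  push_cast
  ring

/-- `τ ↦ E(τ) Z(τ)` is bounded on `ℝ`: `|E(τ)Z(τ)| = 8‖H_0(2τ)‖ ≤ 8M` (`H_0` is bounded on the real
axis). [folklore] -/
theorem UniversalFactor.narrowConv_EZ_bounded :
    ∃ M : ℝ, ∀ τ : ℝ, |‖xiGammaFactor (1 / 2 + (τ : ℂ) * I)‖ * hardyZ τ| ≤ M := by
  obtain ⟨M, -, hM⟩ := norm_deBruijnH_zero_le_of_im 0
  refine ⟨8 * M, fun τ => ?_⟩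
  have h := hM ((2 * τ : ℝ) : ℂ) (by simp)
  rw [UniversalFactor.narrowConv_deBruijnH_two_mul, norm_neg, Complex.norm_real, Real.norm_eq_abs,
    abs_div, abs_of_pos (by norm_num : (0 : ℝ) < 8)] at h
  linarith

/-- `τ ↦ E(τ) Z(τ)` is continuous. [folklore] -/
theorem UniversalFactor.narrowConv_EZ_continuous :
    Continuous fun τ : ℝ => ‖xiGammaFactor (1 / 2 + (τ : ℂ) * I)‖ * hardyZ τ :=
  (continuous_xiGammaFactor_vertical (J := 1 / 2) (by norm_num)).norm.mul continuous_hardyZ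

/-! ## `F_a` on the critical line -/

/-- **The Laplace smoothing on the critical line**: for `a > 0` and real `t`,
`F_a(2t) = −(a/8) ∫ℝ e^{−2a|u|} E(t+u) Z(t+u) du` (substitute `y = −2u` in
`F_a(2t) = ∫ℝ (a/2)e^{−a|y|} H_0(2t − y) dy` and use `H_0(2τ) = −E(τ)Z(τ)/8`). [folklore] -/
theorem UniversalFactor.narrowConv_laplace_two_mul {a : ℝ} (ha : 0 < a) (t : ℝ) :
    deBruijnHDiv (fun u : ℝ => 1 + u ^ 2 / a ^ 2) ((2 * t : ℝ) : ℂ) =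
      ((-(a / 8) * ∫ u : ℝ, Real.exp (-(2 * a * |u|)) *
        ‖xiGammaFactor (1 / 2 + ((t + u : ℝ) : ℂ) * I)‖ * hardyZ (t + u) : ℝ) : ℂ) := by
  rw [deBruijnHDiv_laplace_eq_conv ha]
  set G : ℝ → ℂ := fun y => ((a / 2 * Real.exp (-(a * |y|)) : ℝ) : ℂ) *
    deBruijnH 0 (((2 * t : ℝ) : ℂ) - y) with hGdef
  have hscale : (∫ x : ℝ, G (-2 * x)) = |(-2 : ℝ)⁻¹| • ∫ y : ℝ, G y :=
    Measure.integral_comp_mul_left G (-2)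
  have h2 : (∫ y : ℝ, G y) = 2 * ∫ x : ℝ, G (-2 * x) := by
    rw [hscale, abs_inv, abs_neg, abs_two, ← Complex.coe_smul]
    push_cast
    ring
  rw [h2]
  have hG : ∀ x : ℝ, G (-2 * x) = (((a / 2 * Real.exp (-(2 * a * |x|))) *
      (-(‖xiGammaFactor (1 / 2 + ((t + x : ℝ) : ℂ) * I)‖ * hardyZ (t + x) / 8)) : ℝ) : ℂ) := by
    intro x
    simp only [hGdef]
    have h1 : ((2 * t : ℝ) : ℂ) - ((-2 * x : ℝ) : ℂ) = ((2 * (t + x) : ℝ) : ℂ) := by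
      push_cast; ring
    rw [h1, UniversalFactor.narrowConv_deBruijnH_two_mul, abs_mul, abs_neg, abs_two]
    push_cast
    ring
  simp_rw [hG]
  rw [integral_complex_ofReal]
  have hI : (∫ x : ℝ, a / 2 * Real.exp (-(2 * a * |x|)) *
      -(‖xiGammaFactor (1 / 2 + ((t + x : ℝ) : ℂ) * I)‖ * hardyZ (t + x) / 8)) =
      -(a / 16) * ∫ u : ℝ, Real.exp (-(2 * a * |u|)) *
        ‖xiGammaFactor (1 / 2 + ((t + u : ℝ) : ℂ) * I)‖ * hardyZ (t + u) := by
    rw [← MeasureTheory.integral_const_mul]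
    refine integral_congr_ae (Eventually.of_forall fun x => ?_)
    ring
  rw [hI]
  push_cast
  ring

/-! ## The stub -/

/-- **Stub P1 (convolution on the critical line).** For `a > π/8` and real `t`:
`F_a(2t) = −(a/8) ∫ℝ e^{−2a|u|} E(t+u) Z(t+u) du` with `E(τ) = ‖γ(1/2 + iτ)‖`
(`γ = xiGammaFactor`, `Z = hardyZ`, from `F_a = (a/2)e^{−a|·|} ∗ H_0`, `H_0(2τ) = ξ(1/2+iτ)/8`,
`ξ = γ ζ`, `γ(1/2+iτ) e^{−iϑ(τ)} = −E(τ)`); the `t`-derivative of `t ↦ F_a(2t)` is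
`−(a/8) ∫ℝ 2a·sgn(u) e^{−2a|u|} E(t+u) Z(t+u) du` (derivative on the Lipschitz kernel), and this
derivative integral is continuous in `t`. [folklore] -/
theorem UniversalFactor.stub_narrowConvolution : ∀ a : ℝ, π / 8 < a → ∀ t : ℝ,
    ((deBruijnHDiv (fun u : ℝ => 1 + u ^ 2 / a ^ 2) ((2 * t : ℝ) : ℂ)).re =
      -(a / 8) * ∫ u : ℝ, Real.exp (-(2 * a * |u|)) *
        ‖xiGammaFactor (1 / 2 + ((t + u : ℝ) : ℂ) * I)‖ * hardyZ (t + u)) ∧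
    HasDerivAt (fun s : ℝ => (deBruijnHDiv (fun u : ℝ => 1 + u ^ 2 / a ^ 2) ((2 * s : ℝ) : ℂ)).re)
      (-(a / 8) * ∫ u : ℝ, (2 * a * Real.sign u) * Real.exp (-(2 * a * |u|)) *
        ‖xiGammaFactor (1 / 2 + ((t + u : ℝ) : ℂ) * I)‖ * hardyZ (t + u)) t ∧
    Continuous (fun s : ℝ => ∫ u : ℝ, (2 * a * Real.sign u) * Real.exp (-(2 * a * |u|)) *
        ‖xiGammaFactor (1 / 2 + ((s + u : ℝ) : ℂ) * I)‖ * hardyZ (s + u)) := by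
  intro a ha t
  have ha0 : 0 < a := lt_trans (by positivity) ha
  have hb : 0 < 2 * a := by positivity
  obtain ⟨M, hM⟩ := UniversalFactor.narrowConv_EZ_bounded
  have hg := UniversalFactor.narrowConv_EZ_continuous
  have hre : ∀ s : ℝ, (deBruijnHDiv (fun u : ℝ => 1 + u ^ 2 / a ^ 2) ((2 * s : ℝ) : ℂ)).re =
      -(a / 8) * ∫ u : ℝ, Real.exp (-(2 * a * |u|)) *
        ‖xiGammaFactor (1 / 2 + ((s + u : ℝ) : ℂ) * I)‖ * hardyZ (s + u) := fun s => by
    rw [UniversalFactor.narrowConv_laplace_two_mul ha0 s, Complex.ofReal_re]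
  refine ⟨hre t, ?_, ?_⟩
  · have hD := (UniversalFactor.narrowConv_hasDerivAt_kernel hb hg hM t).const_mul (-(a / 8))
    have hfun :
        (fun s : ℝ => (deBruijnHDiv (fun u : ℝ => 1 + u ^ 2 / a ^ 2) ((2 * s : ℝ) : ℂ)).re) =
        fun s => -(a / 8) * ∫ u : ℝ, Real.exp (-(2 * a * |u|)) *
          (‖xiGammaFactor (1 / 2 + ((s + u : ℝ) : ℂ) * I)‖ * hardyZ (s + u)) := by
      funext s
      rw [hre s]
      simp only [mul_assoc]
    rw [hfun]
    simpa only [mul_assoc] using hD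
  · simpa only [mul_assoc] using UniversalFactor.narrowConv_continuous_kernel hb hg hM

end Summit.RiemannHypothesis.RiemannHypothesis.Theorems
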